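/-
Copyright (c) 2026 the pub-hodgecm-mathlib formalisation cell (harness21).  Prover seat hodgecm-mathlib-F0P3a-p04 (g30), carve (c8) of SIG-F3-5 v1 (pen LH7-p04 (g12),
00:24:06Z target `hgate`), heir LEAD F0P3a-plan (g16) T14-66 ∕ T15-08, 2026-09-03.
-/
import Literature.NumberTheory.Automorphic.TypeTwoGateAtOverOrderGenerator     -- ★ (c8)-L8 p853038 (this seat): the gate's eigen-data at a unitary generator; brings the ★ F4 gate `exists_selfDual_cyclic_iff_even_log_uniform`
import Literature.NumberTheory.Rogawski1990.EndoscopicBlockFrameBridgeInputs   -- ★ (c5-i) p853057 (LH10-p01): `charpoly_blockFrame`, `blockFrame_mulVec_frameVector`, `frameVector_ne_zero` (block frame `φ (h, s) = c·[h ⊕ s]·c⁻¹`)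
import HarnessLib

/-!
# The F4 gate at a unitary generator of a glued over-order — the block frame reads the endoscopic frame (carve (c8), matrix side + corollary, uniformiser row)

Topic `NumberTheory/Automorphic`; namespace `Literature.NumberTheory.Automorphic.SymmetricEigenframe` (the gate's).  THEOREMS ONLY (no definition, no instance, no notation, no named
fact, no `sorry`); count-neutral; kernel lane `--supports stmt-HodgeConjecture-24833`.  Cell `pub/hodgecm-mathlib` (D-0151), crux H413; road M6, route (B) «TOT-Λ by over-orders»,
F3-5b's binder `hgate` (pen LH7-p04 (g12) 00:24:06Z): «for a good glued over-order `G(N″, b, c′) = 𝒪_E[x′]`, `x′ = (u′, λ′)` deep unitary of exponents `(N″, b)` (★ (UG)), a self-dual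
`x′`-cyclic lattice exists iff `ord⟨x₀, x₀⟩_J + b` is even».  Design memo `F0/P3a/F0P3a-p04/g30/f35/C8-gate-at-generator.v1.F0P3ap04g30.md` bca68c90 §3 (C8-odd).

§1 THE ENDOSCOPIC FRAME IS THE BLOCK FRAME: for ★ (c5-ii-B) `exists_endoscopicFrame_of_blockFrame(_unitary)`'s `φ′ : E × K →ₐ[E] M₃(E)` (`φ′ (u, λ) = φ (g, u)`, every `b = P(u, λ)`),
**`φ′ (s, p + q·λ) = φ (p•1 + q•g, s)`** (`algHom_prod_apply_eq_blockFrame`) — both sides are `P(τ)`, and `P(g) = p•1 + q•g` because `P − (p + qX)` vanishes at `λ`, hence is a multiple of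
the minimal polynomial `χ_g = X² − (tr g)X + det g` (irreducible: rootless of degree 2), which `g` kills (Cayley–Hamilton).  With it: `charpoly (φ′ (s, z)) = (X − C s)·(X² − C (tr ẑ)X + C (det ẑ))`
(★ (c5-i) (P1)), `φ′ (s, z) *ᵥ x₀ = s • x₀` at `x₀ := c·e₂` (★ (c5-i) (P3)), and `z² − (tr ẑ)z + det ẑ = 0` (`quad_of_coord`).
§2 **C8-odd `gate_at_generator_uniform`**: the ★ F4 gate `exists_selfDual_cyclic_iff_even_log_uniform` AT `τ′ := φ′ x′`, `x′ = (u′, λ′)`, `λ′ = p′ + q′·θ` (`θ` the `ι`-anti-fixed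
uniformiser of the gate's package = ROW U's Eisenstein generator), fed: `hτU′` from `hstar` + `x′·x′⋆ = 1`; `hχ′`, `hx₀′` from §1; `hσu′`, `hσλ′` from unitarity; `hu1′`; and the eigen-data
`hlamO′ hlam1′ hne′ hexpn′ (n := b) hexpN′ (N := N″ + s)` from ★ (c8)-L8 (`|θ − ιθ| = exp(−(2s+1))`, `s = ord_E 2`, `0` tame).  Conclusion = the gate's, at `τ′`, with `+ b`:
`(∃ w, ∃ g₁ ∈ U(σ,J), span (range fun k => (τ′^k) *ᵥ w) = span (range g₁ᵀ)) ↔ Even (log|ᵗσ(x₀)Jx₀| + b)`.  The W-UNIT row (★ p852848's frame) is the sibling C8-unit (same §1).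
[cite: Rogawski1990, §4.9 Lemma 4.9.3 p. 56, Prop. 4.9.1 (b) p. 55] [cite: Jacobowitz1962, §7 Thm. 7.1] [cite: Lang2002, Ch. XIV §3] [cite: SerreLocalFields1979, Ch. III §6 Cor. 2]
HONEST LABEL: count-neutral; zero label movement until F5 ★ + a desk-priced rider; HC_CM is proved only modulo the 7 printed citations (2 remaining named inputs: hLiu418 =
stmt-HodgeConjecture-24832, h413 = stmt-HodgeConjecture-24833) until rung 0 closes.

## References
* [Rogawski1990] J. D. Rogawski, *Automorphic Representations of Unitary Groups in Three Variables*, Ann. of Math. Stud. 123 (1990): §4.9 Lemma 4.9.3 p. 56, Prop. 4.9.1 (b) p. 55.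
* [Jacobowitz1962] R. Jacobowitz, *Hermitian forms over local fields*, Amer. J. Math. 84 (1962): §7 Thm. 7.1 (lattices of an order).
* [Lang2002] S. Lang, *Algebra*, GTM 211 (2002): Ch. XIV §3 (characteristic polynomial, Cayley–Hamilton), Ch. V §1 (minimal polynomial of an algebraic element).
* [SerreLocalFields1979] J.-P. Serre, *Local Fields*, GTM 67 (1979): Ch. III §6 Cor. 2 (different of a monogenic order).
-/

set_option autoImplicit false

noncomputable section

open Polynomial Matrix
open scoped MatrixGroups ValuativeRel WithZero

namespace Literature.NumberTheory.Automorphic.SymmetricEigenframe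

open Literature.NumberTheory.Rogawski1990 Literature.NumberTheory.Automorphic Literature.NumberTheory.Automorphic.UnitaryGroup

/-! ## §1 The endoscopic frame `φ′` reads the block frame `φ` -/

section Frame

variable {E K : Type*} [Field E] [Field K] [Algebra E K]

/-- In `K = E(λ)` with `λ² − tλ + D = 0`: `(p + qλ)² − tr(p•1 + q•g)·(p + qλ) + det(p•1 + q•g) = 0` for ANY `g` with `tr g = t`, `det g = D` — the element and its matrix have the same
quadratic relation. [cite: Lang2002, Ch. XIV §3] -/
theorem quad_of_coord (g : Matrix (Fin 2) (Fin 2) E) {lam : K}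
    (hlam : lam ^ 2 - algebraMap E K g.trace * lam + algebraMap E K g.det = 0) (p q : E) :
    (algebraMap E K p + algebraMap E K q * lam) ^ 2 - algebraMap E K (p • (1 : Matrix (Fin 2) (Fin 2) E) + q • g).trace * (algebraMap E K p + algebraMap E K q * lam) +
      algebraMap E K (p • (1 : Matrix (Fin 2) (Fin 2) E) + q • g).det = 0 := by
  have htr : (p • (1 : Matrix (Fin 2) (Fin 2) E) + q • g).trace = 2 * p + q * g.trace := by
    rw [Matrix.trace_add, Matrix.trace_smul, Matrix.trace_smul, Matrix.trace_one, Fintype.card_fin, smul_eq_mul, smul_eq_mul]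
    push_cast
    ring
  have hdet : (p • (1 : Matrix (Fin 2) (Fin 2) E) + q • g).det = p * p + p * q * g.trace + q * q * g.det := by
    rw [Matrix.det_fin_two, Matrix.trace_fin_two, Matrix.det_fin_two]
    simp only [Matrix.add_apply, Matrix.smul_apply, Matrix.one_apply_eq, Matrix.one_apply_ne (by decide : (0 : Fin 2) ≠ 1),
      Matrix.one_apply_ne (by decide : (1 : Fin 2) ≠ 0), smul_eq_mul, mul_one, mul_zero, zero_add]
    ring
  rw [htr, hdet]
  simp only [map_add, map_mul, map_ofNat]
  linear_combination (algebraMap E K q) ^ 2 * hlam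

/-- **THE ENDOSCOPIC FRAME IS THE BLOCK FRAME.**  For an `E`-algebra map `φ : M₂(E) × E → M₃(E)` and an `E`-algebra map `φ′ : E × K → M₃(E)` with `φ′ (u, λ) = φ (g, u)` and
`E × K = E[(u, λ)]`, where `λ ∈ K ∖ E` is a root of `χ_g = X² − (tr g)X + det g` (rootless in `E`): `φ′ (s, p + qλ) = φ (p•1 + q•g, s)`.  (Both are `P(φ(g,u))` for the polynomial
`P` with `P(u, λ) = (s, p + qλ)`; `P(g) = p•1 + q•g` since `χ_g = minpoly_E λ` divides `P − (p + qX)` and `χ_g(g) = 0`.) [cite: Lang2002, Ch. XIV §3; Ch. V §1] -/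
theorem algHom_prod_apply_eq_blockFrame (φ : (Matrix (Fin 2) (Fin 2) E × E) →ₐ[E] Matrix (Fin 3) (Fin 3) E)
    (g : Matrix (Fin 2) (Fin 2) E) (u : E) (hirr : ∀ x : E, x * x - g.trace * x + g.det ≠ 0) {lam : K}
    (hlam : lam ^ 2 - algebraMap E K g.trace * lam + algebraMap E K g.det = 0)
    (φ' : (E × K) →ₐ[E] Matrix (Fin 3) (Fin 3) E) (hφ'x : φ' ((u, lam) : E × K) = φ (g, u))
    (hall : ∀ b : E × K, ∃ P : E[X], aeval ((u, lam) : E × K) P = b) (s p q : E) :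
    φ' ((s, algebraMap E K p + algebraMap E K q * lam) : E × K) = φ (p • (1 : Matrix (Fin 2) (Fin 2) E) + q • g, s) := by
  obtain ⟨P, hP⟩ := hall ((s, algebraMap E K p + algebraMap E K q * lam) : E × K)
  -- the two coordinates of `P(u, λ) = (s, p + qλ)`
  have hPu : aeval u P = s := by
    have h := congrArg Prod.fst hP
    rwa [show (aeval ((u, lam) : E × K) P).1 = aeval u P from
      (Polynomial.aeval_algHom_apply (AlgHom.fst E E K) ((u, lam) : E × K) P).symm] at h
  have hPlam : aeval lam P = algebraMap E K p + algebraMap E K q * lam := by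
    have h := congrArg Prod.snd hP
    rwa [show (aeval ((u, lam) : E × K) P).2 = aeval lam P from
      (Polynomial.aeval_algHom_apply (AlgHom.snd E E K) ((u, lam) : E × K) P).symm] at h
  -- `χ_g` is the minimal polynomial of `λ`; it divides `P − (p + qX)`
  set χ : E[X] := X ^ 2 - C g.trace * X + C g.det with hχdef
  have hχg' : g.charpoly = χ := Matrix.charpoly_fin_two g
  have hχmonic : χ.Monic := hχg' ▸ Matrix.charpoly_monic g
  have hχdeg : χ.natDegree = 2 := by rw [← hχg', Matrix.charpoly_natDegree_eq_dim, Fintype.card_fin]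
  have hχlam : aeval lam χ = 0 := by
    rw [hχdef, map_add, map_sub, map_mul, aeval_C, aeval_X, map_pow, aeval_X, aeval_C]; exact hlam
  have hχirr : Irreducible χ := by
    rw [hχmonic.irreducible_iff_roots_eq_zero_of_degree_le_three (by omega) (by omega), Multiset.eq_zero_iff_forall_notMem]
    intro x hx
    rw [mem_roots hχmonic.ne_zero, IsRoot.def, hχdef, eval_add, eval_sub, eval_mul, eval_C, eval_X, eval_pow, eval_X, eval_C] at hx
    exact hirr x (by linear_combination hx)
  have hmin : χ = minpoly E lam := minpoly.eq_of_irreducible_of_monic hχirr hχlam hχmonic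
  have hdvd : χ ∣ P - (C p + C q * X) := by
    rw [hmin]; refine minpoly.dvd E lam ?_
    rw [map_sub, map_add, map_mul, aeval_C, aeval_C, aeval_X, hPlam, sub_self]
  -- hence `P(g) = p•1 + q•g` (Cayley–Hamilton)
  have hχg : aeval g χ = 0 := by rw [← hχg']; exact Matrix.aeval_self_charpoly g
  have hPg : aeval g P = p • (1 : Matrix (Fin 2) (Fin 2) E) + q • g := by
    obtain ⟨Q, hQ⟩ := hdvd
    have h : aeval g (P - (C p + C q * X)) = 0 := by rw [hQ, map_mul, hχg, zero_mul]
    rw [map_sub, sub_eq_zero, map_add, map_mul, aeval_C, aeval_C, aeval_X, Algebra.algebraMap_eq_smul_one, Algebra.algebraMap_eq_smul_one, smul_one_mul] at h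
    exact h
  -- both sides are `P(τ)`
  have h1 : φ' ((s, algebraMap E K p + algebraMap E K q * lam) : E × K) = aeval (φ (g, u)) P := by
    rw [← hP, ← Polynomial.aeval_algHom_apply, hφ'x]
  have h2 : aeval (φ (g, u)) P = φ (aeval ((g, u) : Matrix (Fin 2) (Fin 2) E × E) P) := Polynomial.aeval_algHom_apply φ _ P
  have h3 : aeval ((g, u) : Matrix (Fin 2) (Fin 2) E × E) P = (p • (1 : Matrix (Fin 2) (Fin 2) E) + q • g, s) := by
    refine Prod.ext ?_ ?_
    · rw [show (aeval ((g, u) : Matrix (Fin 2) (Fin 2) E × E) P).1 = aeval g P from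
        (Polynomial.aeval_algHom_apply (AlgHom.fst E (Matrix (Fin 2) (Fin 2) E) E) ((g, u) : Matrix (Fin 2) (Fin 2) E × E) P).symm, hPg]
    · rw [show (aeval ((g, u) : Matrix (Fin 2) (Fin 2) E × E) P).2 = aeval u P from
        (Polynomial.aeval_algHom_apply (AlgHom.snd E (Matrix (Fin 2) (Fin 2) E) E) ((g, u) : Matrix (Fin 2) (Fin 2) E × E) P).symm, hPu]
  rw [h1, h2, h3]

end Frame

/-! ## §2 C8-odd: the F4 gate at the generator, uniformiser ∕ W-odd row -/

section Gate

/-- **C8-odd — THE F4 GATE AT A UNITARY GENERATOR OF A GLUED OVER-ORDER (uniformiser ∕ W-odd row).**  In the endoscopic frame of `τ = φ (g, u)` (block frame `φ`, ★ (c5-ii-B)'s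
`φ′` with `φ′ (u, λ) = τ`, `E × K = E[(u, λ)]`, `hstar`), for a generator `x′ = (u′, p′ + q′θ)` with ★ (UG)'s data — unitary `x′·x′⋆ = 1`, deep `u′ ≡ p′ ≡ 1`, exponents `|q′| = q^{−N″}`,
`λ′² − t′λ′ + D′ = 0`, `|u′² − t′u′ + D′| = q^{−b}` — and the gate's `τ`-free package (`θ` the `ι`-anti-fixed uniformiser, `|θ − ιθ| = q^{−(2s+1)}`): a self-dual `φ′ x′`-cyclic lattice exists
iff `ord⟨x₀, x₀⟩_J + b` is even, `x₀ := c·e₂` the common eigenline.  (= ★ `exists_selfDual_cyclic_iff_even_log_uniform` at `τ′ := φ′ x′` with `n := b`, `N := N″ + s`.)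
[cite: Rogawski1990, §4.9 Lemma 4.9.3 p. 56, Prop. 4.9.1 (b) p. 55] [cite: Jacobowitz1962, §7 Thm. 7.1] [cite: SerreLocalFields1979, Ch. III §6 Cor. 2] -/
theorem gate_at_generator_uniform
    {E K : Type*} [Field E] [Valued E ℤᵐ⁰] [ValuativeRel E] [(Valued.v : Valuation E ℤᵐ⁰).Compatible]
    [Field K] [Valued K ℤᵐ⁰] [ValuativeRel K] [(Valued.v : Valuation K ℤᵐ⁰).Compatible] [Algebra E K]
    -- the gate's `τ`-free package (★ `exists_selfDual_cyclic_iff_even_log_uniform`'s letters, `j := algebraMap E K`)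
    (σ : E →+* E) (hσσ : ∀ x, σ (σ x) = x) (hσO : ∀ x : 𝒪[E], σ x ∈ 𝒪[E])
    (hnorm : ∀ u : 𝒪[E], IsUnit u → σ u = u → ∃ t : 𝒪[E], (t : E) * σ t = u)
    (h20 : (2 : E) ≠ 0) {ω : E} (hω : Valued.v ω ≤ 1) (hωtr : Valued.v (ω + σ ω) = 1)
    (J : GL (Fin 3) E) (hJ : J ∈ glInt 3 E) (hJh : ((J : Matrix (Fin 3) (Fin 3) E).map σ)ᵀ = J)
    (hjv : ∀ x, Valued.v (algebraMap E K x) = Valued.v x ^ 2)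
    (σK ι : K →+* K) (hσj : ∀ x, σK (algebraMap E K x) = algebraMap E K (σ x)) (hσKσK : ∀ y, σK (σK y) = y)
    (hσKv : ∀ y, Valued.v (σK y) = Valued.v y)
    (hιj : ∀ x, ι (algebraMap E K x) = algebraMap E K x) (hιι : ∀ y, ι (ι y) = y) (hιv : ∀ y, Valued.v (ι y) = Valued.v y)
    (hσKι : ∀ y, σK (ι y) = ι (σK y))
    {θ : K} (hθv : Valued.v θ = WithZero.exp (-1 : ℤ)) (hιθ : ι θ = -θ)
    (hcoord : ∀ z : K, ∃! pq : E × E, z = algebraMap E K pq.1 + algebraMap E K pq.2 * θ)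
    (hrE : ∀ x : K, x ≠ 0 → ι x = x → Even (WithZero.log (Valued.v x)))
    (hnK : ∀ c : K, c ≠ 0 → σK c = c → Even (WithZero.log (Valued.v c)) → ∃ a : K, a * σK a * c = 1)
    (hnE : ∀ c : K, c ≠ 0 → σK c = c → ι c = c → (4 : ℤ) ∣ WithZero.log (Valued.v c) → ∃ a : K, ι a = a ∧ a * σK a * c = 1)
    {s : ℕ} (hθs : Valued.v (θ - ι θ) = WithZero.exp (-((2 * s + 1 : ℕ) : ℤ)))
    -- the block ∕ endoscopic frame of `τ = φ (g, u)` (★ (O-5) p852929, ★ (c5-i) p853057, ★ (c5-ii-B) p853134)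
    (cfr : GL (Fin 3) E) (φ : (Matrix (Fin 2) (Fin 2) E × E) →ₐ[E] Matrix (Fin 3) (Fin 3) E)
    (hφ : ∀ (g : Matrix (Fin 2) (Fin 2) E) (u : E),
      φ (g, u) = (cfr : Matrix (Fin 3) (Fin 3) E) * Matrix.reindex endoPerm endoPerm (Matrix.fromBlocks g 0 0 (u • (1 : Matrix (Fin 1) (Fin 1) E))) *
        ((cfr⁻¹ : GL (Fin 3) E) : Matrix (Fin 3) (Fin 3) E))
    (g : Matrix (Fin 2) (Fin 2) E) (u : E) (hirr : ∀ x : E, x * x - g.trace * x + g.det ≠ 0) {lam : K}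
    (hlam : lam ^ 2 - algebraMap E K g.trace * lam + algebraMap E K g.det = 0)
    (φ' : (E × K) →ₐ[E] Matrix (Fin 3) (Fin 3) E) (hφ'x : φ' ((u, lam) : E × K) = φ (g, u))
    (hall : ∀ b : E × K, ∃ P : E[X], aeval ((u, lam) : E × K) P = b)
    (hstar : ∀ b : E × K, (J : Matrix (Fin 3) (Fin 3) E) * φ' (RingHom.prodMap σ σK b) = ((φ' b).map σ)ᵀ * (J : Matrix (Fin 3) (Fin 3) E))
    (hcoordlam : ∀ z : K, ∃ p q : E, z = algebraMap E K p + algebraMap E K q * lam)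
    -- the generator `x′ = (u′, p′ + q′θ)` with ★ (UG)'s data (i)–(iii)
    {u' p' q' t' D' : E} {N'' b : ℕ}
    (hunit : ((u', algebraMap E K p' + algebraMap E K q' * θ) : E × K) *
      RingHom.prodMap σ σK ((u', algebraMap E K p' + algebraMap E K q' * θ) : E × K) = 1)
    (hu1 : Valued.v (u' - 1) < 1) (hp1 : Valued.v (p' - 1) < 1) (hq : Valued.v q' = WithZero.exp (-(N'' : ℤ)))
    (hquad' : (algebraMap E K p' + algebraMap E K q' * θ) ^ 2 - algebraMap E K t' * (algebraMap E K p' + algebraMap E K q' * θ) +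
      algebraMap E K D' = 0)
    (hb : Valued.v (u' * u' - t' * u' + D') = WithZero.exp (-(b : ℤ))) :
    (∃ w : Fin 3 → E, ∃ g₁ ∈ unitaryGroupOfForm σ (J : Matrix (Fin 3) (Fin 3) E),
      Submodule.span 𝒪[E] (Set.range fun k : Fin 3 =>
        ((φ' ((u', algebraMap E K p' + algebraMap E K q' * θ) : E × K)) ^ (k : ℕ)) *ᵥ w) =
        Submodule.span 𝒪[E] (Set.range ((g₁ : Matrix (Fin 3) (Fin 3) E))ᵀ)) ↔
    Even (WithZero.log (Valued.v (∑ k, ∑ i, σ (((cfr : Matrix (Fin 3) (Fin 3) E) *ᵥ Pi.single (endoPerm (Sum.inr 0)) (1 : E)) i) *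
      (J : Matrix (Fin 3) (Fin 3) E) i k * ((cfr : Matrix (Fin 3) (Fin 3) E) *ᵥ Pi.single (endoPerm (Sum.inr 0)) (1 : E)) k)) + b) := by
  -- the generator, its eigenline, its `λ`-coordinates
  set lam' : K := algebraMap E K p' + algebraMap E K q' * θ with hlam'def
  obtain ⟨p, q, hpq⟩ := hcoordlam lam'
  have hφ'x' : φ' ((u', lam') : E × K) = φ (p • (1 : Matrix (Fin 2) (Fin 2) E) + q • g, u') := by
    rw [hpq]; exact algHom_prod_apply_eq_blockFrame φ g u hirr hlam φ' hφ'x hall u' p q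
  -- §1: characteristic polynomial and eigenline at `τ′`
  have hχ' : (φ' ((u', lam') : E × K)).charpoly =
      (X - C u') * (X ^ 2 - C (p • (1 : Matrix (Fin 2) (Fin 2) E) + q • g).trace * X + C (p • (1 : Matrix (Fin 2) (Fin 2) E) + q • g).det) := by
    rw [hφ'x', charpoly_blockFrame cfr φ hφ, Matrix.charpoly_fin_two, mul_comm]
  have hx₀' : φ' ((u', lam') : E × K) *ᵥ ((cfr : Matrix (Fin 3) (Fin 3) E) *ᵥ Pi.single (endoPerm (Sum.inr 0)) (1 : E)) =
      u' • ((cfr : Matrix (Fin 3) (Fin 3) E) *ᵥ Pi.single (endoPerm (Sum.inr 0)) (1 : E)) := by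
    rw [hφ'x']; exact blockFrame_mulVec_frameVector cfr φ hφ _ _
  have hx₀0 := frameVector_ne_zero cfr
  have hquad₁ : lam' ^ 2 - algebraMap E K (p • (1 : Matrix (Fin 2) (Fin 2) E) + q • g).trace * lam' +
      algebraMap E K (p • (1 : Matrix (Fin 2) (Fin 2) E) + q • g).det = 0 := by
    rw [hpq]; exact quad_of_coord g hlam p q
  -- unitarity: `σu′·u′ = 1`, `λ′·σλ′ = 1`, `(σ τ′)ᵀ J τ′ = J` (from `hstar`)
  have hσu' : σ u' * u' = 1 := by
    have h := congrArg Prod.fst hunit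
    change u' * σ u' = 1 at h
    rwa [mul_comm] at h
  have hσlam' : lam' * σK lam' = 1 := by
    have h := congrArg Prod.snd hunit
    change lam' * σK lam' = 1 at h
    exact h
  have hτU' : ((φ' ((u', lam') : E × K)).map σ)ᵀ * (J : Matrix (Fin 3) (Fin 3) E) * φ' ((u', lam') : E × K) = J := by
    rw [← hstar, Matrix.mul_assoc, ← map_mul,
      show RingHom.prodMap σ σK ((u', lam') : E × K) * (u', lam') = 1 by rw [mul_comm]; exact hunit, map_one, Matrix.mul_one]
  -- the eigen-data via ★ (c8)-L8
  have hθ0 : θ ≠ 0 := fun h => by rw [h, map_zero] at hθv; exact WithZero.exp_ne_zero hθv.symm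
  have hθ1 : Valued.v θ < 1 := by rw [hθv, ← WithZero.exp_zero]; exact WithZero.exp_lt_exp.2 (by norm_num)
  have h2K : (2 : K) ≠ 0 := by rw [← map_ofNat (algebraMap E K) 2]; exact (map_ne_zero (algebraMap E K)).2 h20
  have hιθne : ι θ ≠ θ := by
    rw [hιθ]; intro h
    exact (mul_ne_zero h2K hθ0) (by linear_combination -h)
  have hq0 : q' ≠ 0 := fun h => by rw [h, map_zero] at hq; exact WithZero.exp_ne_zero hq.symm
  have hq1 : Valued.v q' ≤ 1 := by rw [hq, ← WithZero.exp_zero]; exact WithZero.exp_le_exp.2 (by omega)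
  have hp1' : Valued.v p' ≤ 1 := by
    have h := Valuation.map_one_add_of_lt (Valued.v : Valuation E ℤᵐ⁰) hp1
    rw [add_sub_cancel] at h
    exact h.le
  have hlamO' : lam' ∈ 𝒪[K] := (v_le_one_iff_mem_integer _).1 (v_generator_le_one (algebraMap E K) hjv hθ1.le hp1' hq1)
  have hlam1' := v_generator_sub_one_lt_one (algebraMap E K) hjv hθ1 hp1 hq1
  have hne' := iota_generator_ne (algebraMap E K) ι hιj hιθne hq0 (p' := p')
  have hexpn' := v_j_sub_generator_eq_exp (algebraMap E K) hjv ι hιj hιv hquad' hne' hb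
  have hexpN' := v_generator_sub_iota_eq_exp (algebraMap E K) hjv ι hιj hθs hq (p' := p')
  exact exists_selfDual_cyclic_iff_even_log_uniform σ hσσ hσO hnorm h20 hω hωtr J hJ hJh _ hτU' hχ' hσu' hu1 hx₀' hx₀0
    (algebraMap E K) hjv σK ι hσj hσKσK hσKv hιj hιι hιv hσKι hθv hιθ hcoord hquad₁ hlamO' hlam1' hσlam' hne' hexpn' hexpN' hrE hnK hnE

end Gate

end Literature.NumberTheory.Automorphic.SymmetricEigenframe

end
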